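import Literature.NumberTheory.Sieve.FouvryTenenbaumDivisorAP
import Literature.NumberTheory.LFunctions.KloostermanIncompleteInterval
import HarnessLib

/-!
# Fouvry–Tenenbaum 2021, Lemma 4.12 (4.16): `τ₂` in arithmetic progressions to level `x^{3/5}` — PROVED

É. Fouvry, G. Tenenbaum, *Multiplicative functions in large arithmetic progressions and
applications*, Trans. Amer. Math. Soc. 375 (2022) 245–299, doi:10.1090/tran/8442
(`FouvryTenenbaum2021`; held as `paper:doi-10-1090-tran-8442`, Lemma 4.12 on PDF p. 20).
This file DISCHARGES the named fact `Literature.NumberTheory.Sieve.FouvryTenenbaum2021_lemma412` of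
`FouvryTenenbaumDivisorAP.lean` ((4.16) rendered at the fixed admissible exponent `3/5 = 2/3 − 1/15`):

* `FouvryTenenbaum2021_lemma412_holds : FouvryTenenbaum2021_lemma412` (with `δ = 1/20`, `C₀ = 0`).

(The sibling `FouvryTenenbaumDivisorAPProofs.lean` proves the trivial-count layer `s ≤ x^{1/(k+1)−δ}`
of Lemmas 4.12–4.13; the present file is the Weil range of Lemma 4.12 and is independent of it.)

The source gives no proof beyond (p. 20) "First consider the case where `D = 1`. The bound (4.16) is
then a classical consequence of Weil's bound for Kloosterman sums. … Let us now consider the case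
where `D > 1`. The congruences `mᵢ ≡ tᵢ (mod D)` may be detected by means of additive characters
modulo `D`. It is standard to incorporate these extra characters in the proofs of (4.16)".  We
formalize the classical argument, every input of which is PROVED in the tree: Weil's bound
`|S(m, n; c)| ≤ (m, n, c)^{1/2} c^{1/2} τ(c)` (`Literature.NumberTheory.LFunctions.weil_kloosterman_bound_holds`,
Stepanov–Schmidt), entering through the completion estimate for incomplete Kloosterman sums over a
progression `Literature.NumberTheory.LFunctions.KI_sum_progression_le` (Bettin–Chandee, Appendix
Lemma 1 / Duke–Friedlander–Iwaniec 1997 Lemma 8), the finite Fourier analysis on `ℤ/sℤ` of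
`Sieve/IwaniecAlmostPrimesHooley.lean`, the geometric-sum majorants of
`Sieve/VinogradovExpSumTools.lean`, the Ramanujan-sum bound `|S(0, c; d)| ≤ (c, d)` and the divisor
bound `τ(s) ≤ C_η s^η`.  The classes `mod D` are NOT detected by characters: since `(D, s) = 1`, the
integers `m ≡ t (mod D)` of an interval form a run `v + Dy` of a progression, which the completion
lemma and the geometric sums digest directly (`lemma412_sum_filter_eq_sum_Ioc`); consequently the bound
holds with `C₀ = 0`, uniformly in `D` and in `t₁, t₂` (the hypothesis `(t₁t₂, D) = 1` is not used).

## The argument (`lemma412_core`)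

Write `ψ = e_s`, `α = a mod s` (a unit), `μ = m₁ mod s`, `g_s(n; a) = [n ≡ a (s)] − [(n, s) = 1]/φ(s)`
(`FouvryTenenbaum2021.gAP`).
1. If `μ` is not a unit, `g_s(m₁m₂; a) = 0` for every `m₂`; if it is,
   `g_s(m₁m₂; a) = G_μ(m₂)`, `G_μ(u) = [u = αμ⁻¹] − [u unit]/φ(s)`.
2. Finite Fourier inversion: `G_μ(u) = s⁻¹ ∑_t Ĝ_μ(t) ψ(tu)` with
   `Ĝ_μ(t) = ψ(−tαμ⁻¹) − S(−t, 0; s)/φ(s)`; as `S(0, 0; s) = φ(s)`, `Ĝ_μ(0) = 0`: the two main terms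
   cancel identically (`lemma412_sum_gAP_eq_fourier`).
3. Hence `∑∑ g_s(m₁m₂; a) = s⁻¹ ∑_{t ≠ 0} E(t) F(t)`, `F(t) = ∑_{m₂} ψ(t m₂)` a geometric sum over a
   progression of difference `D`, `|F(t)| ≤ 1/(2‖tD/s‖)` (`lemma412_norm_sum_Ioc_stdAddChar_le`), and
   `E(t) = ∑_{m₁, (m₁,s)=1} ψ((−tα) m̄₁) − N₁ S(−t, 0; s)/φ(s)` with
   `|E(t)| ≤ (t, s) · W`, `W = (R₁ − L₁ + 1)/s + τ(s)√s(1 + log s) + (R₁ − L₁)/φ(s)` by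
   `KI_sum_progression_le` (`(−tα m̄, s)`-gcd `= (t, s)` as `α` is a unit) and `|S(−t,0;s)| ≤ (t, s)`.
4. `∑_{t ≠ 0} (t, s)/(2‖tD/s‖) = ∑_{w ≠ 0} (w, s)/(2‖w/s‖) ≤ τ(s) s (1 + log s)`
   (`lemma412_sum_gcd_div_distInt_le`: `(w, s) ≤ ∑_{d ∣ s, d ∣ w} d` and `w = dj`).
5. So `|∑∑ g| ≤ τ(s)(1 + log s) W`, and with `R₁ − L₁ ≤ M₁ + 1 ≤ √x + 1`, `φ(s) ≤ s ≤ x^{3/5}`,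
   `τ(s) ≤ C_τ s^{1/80}`, `1 + log s ≤ 81 s^{1/80}`:
   `|∑∑ g| φ(s) ≤ 6·81 C_τ x^{21/40} + 81² C_τ² x^{19/20} ≤ 81 C_τ (6 + 81 C_τ) x^{1 − 1/20}`.

## References

* É. Fouvry, G. Tenenbaum, Trans. Amer. Math. Soc. 375 (2022), Lemma 4.12 (4.16) and p. 20.
  [FouvryTenenbaum2021]
* S. Bettin, V. Chandee, Adv. Math. 328 (2018), Appendix, Lemma 1 (completion of incomplete
  Kloosterman sums over a progression). [BettinChandee2018]
* H. Iwaniec, *Spectral Methods of Automorphic Forms*, 2nd ed. (2002), §2.5 (2.25) (Weil's bound).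
  [Iwaniec2002]
-/

noncomputable section

open Finset

namespace Literature.NumberTheory.Sieve

namespace FouvryTenenbaum2021

open Literature.NumberTheory.LFunctions (kloostermanSum kloostermanSum_comm sum_zmod_eq_sum_range
  KI_sum_progression_le KI_stdAddChar_mul_intCast)
open Literature.NumberTheory.Sieve.Iwaniec1978 (hooley_term_eq_stdAddChar hooley_gcd_eq_one_iff_isUnit
  hooley_fourier_inversion hooley_transform_eq_kloostermanSum hooley_norm_sum_range_fourierChar_le
  hooley_separated)
open Literature.NumberTheory.Sieve.Vinogradov (distInt geomBound distInt_nonneg geomBound_nonneg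
  geomBound_le geomBound_le_inv sum_inv_distInt_le_of_separated)
open Literature.NumberTheory.LFunctions.MatomakiMerikoski (norm_kloostermanSum_zero_left_le
  gcd_le_sum_divisors_filter_dvd)

/-! ### Re-indexing a unit class `m ≡ t (mod D)` of an interval as a run of the progression `v + Dy` -/

/-- For `D ≥ 1` and `v ≡ t (mod D)`, the integers `L < m ≤ R` with `m ≡ t (mod D)` are exactly the
`v + Dy` with `⌊(L − v)/D⌋ < y ≤ ⌊(R − v)/D⌋`, so a sum over the class re-indexes over `y`. [folklore] -/
theorem lemma412_sum_filter_eq_sum_Ioc {M : Type*} [AddCommMonoid M] {D : ℕ} (hD : 0 < D)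
    (L R : ℕ) (t v : ℤ) (hv : (v : ZMod D) = (t : ZMod D)) (f : ℤ → M) :
    ∑ m ∈ (Finset.Ioc L R).filter (fun m : ℕ => (m : ZMod D) = (t : ZMod D)), f (m : ℤ) =
      ∑ y ∈ Finset.Ioc (((L : ℤ) - v) / D) (((R : ℤ) - v) / D), f (v + D * y) := by
  have hD0 : (D : ℤ) ≠ 0 := by exact_mod_cast hD.ne'
  have hD0' : (0 : ℤ) < D := by exact_mod_cast hD
  -- membership in the class gives `D ∣ m - v`
  have hdvd : ∀ m : ℕ, ((m : ZMod D) = (t : ZMod D)) → (D : ℤ) ∣ (m : ℤ) - v := by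
    intro m hm
    rw [← hv] at hm
    have : ((v : ℤ) : ZMod D) = ((m : ℤ) : ZMod D) := by rw [Int.cast_natCast, hm]
    exact (ZMod.intCast_eq_intCast_iff_dvd_sub v (m : ℤ) D).mp this
  refine Finset.sum_nbij' (fun m : ℕ => ((m : ℤ) - v) / D) (fun y : ℤ => (v + D * y).toNat)
    ?_ ?_ ?_ ?_ ?_
  · intro m hm
    rw [Finset.mem_filter, Finset.mem_Ioc] at hm
    obtain ⟨⟨hLm, hmR⟩, hcl⟩ := hm
    obtain ⟨c, hc⟩ := hdvd m hcl
    have hc' : ((m : ℤ) - v) / D = c := by rw [hc, Int.mul_ediv_cancel_left _ hD0]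
    rw [Finset.mem_Ioc, hc', Int.ediv_lt_iff_lt_mul hD0', Int.le_ediv_iff_mul_le hD0']
    have hLm' : (L : ℤ) < m := by exact_mod_cast hLm
    have hmR' : (m : ℤ) ≤ R := by exact_mod_cast hmR
    constructor <;> nlinarith
  · intro y hy
    rw [Finset.mem_Ioc, Int.ediv_lt_iff_lt_mul hD0', Int.le_ediv_iff_mul_le hD0'] at hy
    obtain ⟨h1, h2⟩ := hy
    have h0 : 0 ≤ v + D * y := by
      have : (0 : ℤ) ≤ L := by positivity
      nlinarith
    have hcast : (((v + D * y).toNat : ℕ) : ℤ) = v + D * y := Int.toNat_of_nonneg h0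
    rw [Finset.mem_filter, Finset.mem_Ioc]
    refine ⟨⟨?_, ?_⟩, ?_⟩
    · have : (L : ℤ) < ((v + D * y).toNat : ℕ) := by rw [hcast]; nlinarith
      exact_mod_cast this
    · have : (((v + D * y).toNat : ℕ) : ℤ) ≤ R := by rw [hcast]; nlinarith
      exact_mod_cast this
    · rw [← hv]
      have : (((v + D * y).toNat : ℕ) : ZMod D) = (((v + D * y : ℤ)) : ZMod D) := by
        rw [show (((v + D * y).toNat : ℕ) : ZMod D) = ((((v + D * y).toNat : ℕ) : ℤ) : ZMod D) from
          (Int.cast_natCast _).symm, hcast]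
      rw [this]
      push_cast
      rw [ZMod.natCast_self, zero_mul, add_zero]
  · intro m hm
    rw [Finset.mem_filter] at hm
    obtain ⟨c, hc⟩ := hdvd m hm.2
    have hc' : ((m : ℤ) - v) / D = c := by rw [hc, Int.mul_ediv_cancel_left _ hD0]
    have : v + D * (((m : ℤ) - v) / D) = m := by rw [hc']; linarith
    rw [this, Int.toNat_natCast]
  · intro y hy
    rw [Finset.mem_Ioc, Int.ediv_lt_iff_lt_mul hD0', Int.le_ediv_iff_mul_le hD0'] at hy
    obtain ⟨h1, h2⟩ := hy
    have h0 : 0 ≤ v + D * y := by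
      have : (0 : ℤ) ≤ L := by positivity
      nlinarith
    rw [Int.toNat_of_nonneg h0, add_sub_cancel_left, Int.mul_ediv_cancel_left _ hD0]
  · intro m hm
    rw [Finset.mem_filter] at hm
    obtain ⟨c, hc⟩ := hdvd m hm.2
    have hc' : ((m : ℤ) - v) / D = c := by rw [hc, Int.mul_ediv_cancel_left _ hD0]
    congr 1
    rw [hc']
    linarith

/-- The length of the re-indexing interval: `⌊(R − v)/D⌋ − ⌊(L − v)/D⌋ ≤ (R − L)/D + 1 ≤ R − L + 1`
for `L ≤ R`, `D ≥ 1`. [folklore] -/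
theorem lemma412_Ioc_length_le {D : ℕ} (hD : 0 < D) {L R : ℕ} (hLR : L ≤ R) (v : ℤ) :
    ((((R : ℤ) - v) / D - ((L : ℤ) - v) / D : ℤ) : ℝ) ≤ ((R : ℝ) - L) + 1 := by
  have hD0 : (D : ℤ) ≠ 0 := by exact_mod_cast hD.ne'
  have hD0' : (0 : ℤ) < D := by exact_mod_cast hD
  have h1 : ((L : ℤ) - v) < (((L : ℤ) - v) / D + 1) * D := Int.lt_ediv_add_one_mul_self _ hD0'
  have h2 : ((R : ℤ) - v) / D * D ≤ (R : ℤ) - v := Int.ediv_mul_le _ hD0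
  set P : ℤ := ((R : ℤ) - v) / D
  set Q : ℤ := ((L : ℤ) - v) / D
  have hD1 : (1 : ℤ) ≤ D := by exact_mod_cast hD
  have key : P - Q ≤ (R : ℤ) - L + 1 := by
    have h3 : (P - Q - 1) * (D : ℤ) < (R : ℤ) - L := by nlinarith
    rcases le_or_gt 0 (P - Q - 1) with h | h
    · have : P - Q - 1 ≤ (P - Q - 1) * (D : ℤ) := le_mul_of_one_le_right h hD1
      linarith
    · have hLR' : (L : ℤ) ≤ R := by exact_mod_cast hLR
      linarith
  have := (Int.cast_le (R := ℝ)).mpr key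
  push_cast at this ⊢
  linarith

/-! ### The gcd with the modulus is invariant under units -/

/-- `((t u) mod s, s) = (t mod s, s)` for a unit `u` of `ℤ/sℤ`. [folklore] -/
theorem lemma412_gcd_val_mul_of_isUnit {s : ℕ} [NeZero s] (t : ZMod s) {u : ZMod s} (hu : IsUnit u) :
    Nat.gcd (t * u).val s = Nat.gcd t.val s := by
  have key : ∀ (x w : ZMod s), Nat.gcd x.val s ∣ Nat.gcd (x * w).val s := by
    intro x w
    refine Nat.dvd_gcd ?_ (Nat.gcd_dvd_right _ _)
    rw [ZMod.val_mul]
    exact (Nat.dvd_mod_iff (Nat.gcd_dvd_right _ _)).mpr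
      (Dvd.dvd.mul_right (Nat.gcd_dvd_left _ _) _)
  refine Nat.dvd_antisymm ?_ (key t u)
  have h := key (t * u) u⁻¹
  rwa [mul_assoc, ZMod.mul_inv_of_unit u hu, mul_one] at h

/-! ### Counting units: `∑_u [u unit] = φ(s)` and `S(0, 0; s) = φ(s)` -/

/-- `#{u ∈ ℤ/sℤ : u unit} = φ(s)`. [folklore] -/
theorem lemma412_card_filter_isUnit (s : ℕ) [NeZero s] :
    ((Finset.univ : Finset (ZMod s)).filter (fun u => IsUnit u)).card = Nat.totient s := by
  classical
  rw [← ZMod.card_units_eq_totient, ← Fintype.card_subtype]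
  refine Fintype.card_congr ?_
  exact
    { toFun := fun u => u.2.unit
      invFun := fun w => ⟨w, Units.isUnit w⟩
      left_inv := fun u => by ext; simp
      right_inv := fun w => by ext; simp }

/-- The degenerate Kloosterman (Ramanujan) sum `S(0, 0; s) = φ(s)`. [folklore] -/
theorem lemma412_kloostermanSum_zero_zero (s : ℕ) [NeZero s] :
    kloostermanSum s 0 0 = (Nat.totient s : ℂ) := by
  classical
  unfold kloostermanSum
  have : ∀ x : ZMod s, (if IsUnit x then ((ZMod.stdAddChar (0 * x + 0 * x⁻¹) : ℂ)) else 0) =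
      if IsUnit x then (1 : ℂ) else 0 := by
    intro x
    split_ifs
    · rw [zero_mul, zero_mul, add_zero, AddChar.map_zero_eq_one]
    · rfl
  rw [Finset.sum_congr rfl (fun x _ => this x), Finset.sum_boole, lemma412_card_filter_isUnit]

/-! ### Geometric sums over a run of integers against `e_s(w ·)`, `w ≠ 0` -/

/-- For `w ≢ 0 (mod s)`: `‖∑_{z₁ < z ≤ z₂} e_s(w z)‖ ≤ 1/(2 ‖w/s‖)`. [folklore] -/
theorem lemma412_norm_sum_Ioc_stdAddChar_le {s : ℕ} [NeZero s] {w : ZMod s} (hw : w ≠ 0)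
    (z₁ z₂ : ℤ) :
    ‖∑ z ∈ Finset.Ioc z₁ z₂, (ZMod.stdAddChar (w * (z : ZMod s)) : ℂ)‖ ≤
      1 / (2 * distInt (((w.val : ℕ) : ℝ) / s)) := by
  have hs : 0 < s := Nat.pos_of_ne_zero (NeZero.ne s)
  -- `‖w/s‖ ≥ 1/s > 0`
  have hfar : 1 / (s : ℝ) ≤ distInt (((w.val : ℕ) : ℝ) / s) := by
    have hv : w.val ≠ 0 := fun h => hw ((ZMod.val_eq_zero w).mp h)
    have := hooley_separated hs (0 : ℝ) w.val (Finset.mem_range.mpr (ZMod.val_lt w)) 0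
      (Finset.mem_range.mpr hs) hv
    simpa using this
  have hs0 : (0 : ℝ) < s := by exact_mod_cast hs
  have hpos : 0 < distInt (((w.val : ℕ) : ℝ) / s) := lt_of_lt_of_le (by positivity) hfar
  rcases lt_or_ge z₂ z₁ with hlt | hle
  · rw [Finset.Ioc_eq_empty (not_lt.mpr hlt.le), Finset.sum_empty, norm_zero]
    positivity
  obtain ⟨K, hK⟩ : ∃ K : ℕ, (K : ℤ) = z₂ - z₁ := ⟨(z₂ - z₁).toNat, by omega⟩
  set rr : ℕ → ℤ := fun n => z₁ + 1 + (n : ℤ) with hrr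
  have hIoc : Finset.Ioc z₁ z₂ = (Finset.range K).map ⟨rr, fun i j hij => by
      simp only [hrr] at hij; exact_mod_cast (add_left_cancel hij)⟩ := by
    ext m
    simp only [Finset.mem_Ioc, Finset.mem_map, Finset.mem_range, Function.Embedding.coeFn_mk, hrr]
    constructor
    · rintro ⟨h1, h2⟩
      refine ⟨(m - z₁ - 1).toNat, ?_, ?_⟩ <;> omega
    · rintro ⟨n, hn, rfl⟩; omega
  rw [hIoc, Finset.sum_map]
  simp only [Function.Embedding.coeFn_mk]
  simp_rw [KI_stdAddChar_mul_intCast]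
  refine (hooley_norm_sum_range_fourierChar_le z₁ _ (le_refl (K : ℝ))).trans ?_
  exact geomBound_le_inv _ hpos

/-! ### The weighted sum `∑_{w ≠ 0} (w, s)/(2‖w/s‖) ≤ τ(s) s (1 + log s)` -/

/-- `∑_{0 < j < e} 1/(2‖j/e‖) ≤ e (1 + log e)` (the points `j/e` are `1/e`-separated). [folklore] -/
theorem lemma412_sum_range_inv_distInt_le {e : ℕ} (he : 0 < e) :
    ∑ j ∈ Finset.range e, 1 / (2 * distInt ((j : ℝ) / e)) ≤ (e : ℝ) * (1 + Real.log e) := by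
  have he0 : (0 : ℝ) < e := by exact_mod_cast he
  -- the term `j = 0` vanishes (`1/(2·0) = 0`)
  have h0 : 1 / (2 * distInt (((0 : ℕ) : ℝ) / e)) = 0 := by
    simp [Literature.NumberTheory.Sieve.Vinogradov.distInt_zero]
  rw [← Finset.sum_erase (f := fun j : ℕ => 1 / (2 * distInt ((j : ℝ) / e))) (Finset.range e) h0]
  have hδ : (0 : ℝ) < 1 / e := by positivity
  have hm : 1 / (2 * (1 / (e : ℝ))) ≤ (e : ℕ) := by
    rw [show 1 / (2 * (1 / (e : ℝ))) = e / 2 by field_simp]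
    linarith
  have hsep0 := hooley_separated he (0 : ℝ)
  have hsep : ∀ j ∈ (Finset.range e).erase 0, ∀ j' ∈ (Finset.range e).erase 0,
      j ≠ j' → 1 / (e : ℝ) ≤ distInt (((j : ℝ) / e) - ((j' : ℝ) / e)) := by
    intro j hj j' hj' hne
    have := hsep0 j (Finset.mem_of_mem_erase hj) j' (Finset.mem_of_mem_erase hj') hne
    simpa using this
  have hfar : ∀ j ∈ (Finset.range e).erase 0, 1 / (e : ℝ) ≤ distInt ((j : ℝ) / e) := by
    intro j hj
    have hj0 : j ≠ 0 := Finset.ne_of_mem_erase hj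
    have := hsep0 j (Finset.mem_of_mem_erase hj) 0 (Finset.mem_range.mpr he) hj0
    simpa using this
  have h := sum_inv_distInt_le_of_separated ((Finset.range e).erase 0)
    (fun j : ℕ => (j : ℝ) / e) hδ hm hsep hfar
  calc ∑ j ∈ (Finset.range e).erase 0, 1 / (2 * distInt ((j : ℝ) / e))
      ≤ 1 / (1 / (e : ℝ)) * (1 + Real.log e) := h
    _ = (e : ℝ) * (1 + Real.log e) := by rw [one_div_one_div]

/-- **The weighted completion sum**: `∑_{w ≢ 0 (mod s)} (w, s)/(2‖w/s‖) ≤ τ(s) s (1 + log s)`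
(group the `w` by a common divisor `d ∣ s`, `d ∣ w`: `(w, s) ≤ ∑_{d ∣ s, d ∣ w} d`, and `w = d j` gives
`‖w/s‖ = ‖j/(s/d)‖`). [folklore] -/
theorem lemma412_sum_gcd_div_distInt_le (s : ℕ) [NeZero s] :
    ∑ w ∈ (Finset.univ : Finset (ZMod s)).erase 0,
        (Nat.gcd w.val s : ℝ) * (1 / (2 * distInt (((w.val : ℕ) : ℝ) / s))) ≤
      (Nat.divisors s).card * s * (1 + Real.log s) := by
  have hs : 0 < s := Nat.pos_of_ne_zero (NeZero.ne s)
  have hs0 : (0 : ℝ) < s := by exact_mod_cast hs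
  set Φ : ℕ → ℝ := fun k => 1 / (2 * distInt ((k : ℝ) / s)) with hΦ
  have hΦ0 : ∀ k, 0 ≤ Φ k := fun k => by
    simp only [hΦ]
    exact div_nonneg zero_le_one (mul_nonneg zero_le_two (distInt_nonneg _))
  -- Step 1: the sum over all residues, indexed by `0 ≤ k < s`
  have h0 : (Nat.gcd (0 : ZMod s).val s : ℝ) * (1 / (2 * distInt ((((0 : ZMod s).val : ℕ) : ℝ) / s))) = 0 := by
    rw [ZMod.val_zero]
    simp [Literature.NumberTheory.Sieve.Vinogradov.distInt_zero]
  rw [Finset.sum_erase (f := fun w : ZMod s =>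
    (Nat.gcd w.val s : ℝ) * (1 / (2 * distInt (((w.val : ℕ) : ℝ) / s)))) Finset.univ h0,
    sum_zmod_eq_sum_range]
  have hval : ∀ k ∈ Finset.range s, ((k : ZMod s).val : ℕ) = k := fun k hk =>
    ZMod.val_cast_of_lt (Finset.mem_range.mp hk)
  rw [Finset.sum_congr rfl (fun k hk => by rw [hval k hk])]
  -- Step 2: `(k, s) ≤ ∑_{d ∣ s, d ∣ k} d`
  calc ∑ k ∈ Finset.range s, (Nat.gcd k s : ℝ) * (1 / (2 * distInt ((k : ℝ) / s)))
      ≤ ∑ k ∈ Finset.range s, (∑ d ∈ s.divisors.filter (· ∣ k), (d : ℝ)) * Φ k :=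
        Finset.sum_le_sum fun k _ =>
          mul_le_mul_of_nonneg_right (gcd_le_sum_divisors_filter_dvd hs.ne' k) (hΦ0 k)
    _ = ∑ k ∈ Finset.range s, ∑ d ∈ s.divisors, (if d ∣ k then (d : ℝ) * Φ k else 0) := by
        refine Finset.sum_congr rfl fun k _ => ?_
        rw [Finset.sum_filter, Finset.sum_mul]
        refine Finset.sum_congr rfl fun d _ => ?_
        split_ifs <;> simp
    _ = ∑ d ∈ s.divisors, ∑ k ∈ (Finset.range s).filter (d ∣ ·), (d : ℝ) * Φ k := by
        rw [Finset.sum_comm]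
        refine Finset.sum_congr rfl fun d _ => ?_
        rw [Finset.sum_filter]
    _ = ∑ d ∈ s.divisors, (d : ℝ) * ∑ k ∈ (Finset.range s).filter (d ∣ ·), Φ k := by
        refine Finset.sum_congr rfl fun d _ => ?_
        rw [Finset.mul_sum]
    _ ≤ ∑ d ∈ s.divisors, (d : ℝ) * (((s / d : ℕ) : ℝ) * (1 + Real.log s)) := by
        refine Finset.sum_le_sum fun d hd => ?_
        have hd0 : 0 < d := Nat.pos_of_mem_divisors hd
        have hds : d ∣ s := Nat.dvd_of_mem_divisors hd
        refine mul_le_mul_of_nonneg_left ?_ (Nat.cast_nonneg d)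
        -- Step 3: `k = d j`, `0 ≤ j < e := s / d`, and `k/s = j/e`
        set e : ℕ := s / d with he
        have hse : s = d * e := (Nat.mul_div_cancel' hds).symm
        have he0 : 0 < e := Nat.pos_of_ne_zero (fun h => by rw [h, mul_zero] at hse; omega)
        have hmap : (Finset.range s).filter (d ∣ ·) =
            (Finset.range e).map ⟨fun j => d * j, mul_right_injective₀ hd0.ne'⟩ := by
          ext k
          simp only [Finset.mem_filter, Finset.mem_range, Finset.mem_map, Function.Embedding.coeFn_mk]
          constructor
          · rintro ⟨hk, ⟨j, rfl⟩⟩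
            refine ⟨j, ?_, rfl⟩
            rw [hse] at hk
            exact Nat.lt_of_mul_lt_mul_left hk
          · rintro ⟨j, hj, rfl⟩
            refine ⟨?_, Dvd.intro j rfl⟩
            rw [hse]
            exact Nat.mul_lt_mul_of_pos_left hj hd0
        rw [hmap, Finset.sum_map]
        simp only [Function.Embedding.coeFn_mk, hΦ]
        have hresc : ∀ j : ℕ, (((d * j : ℕ) : ℝ)) / s = (j : ℝ) / e := by
          intro j
          rw [hse]
          have hd0' : (d : ℝ) ≠ 0 := by exact_mod_cast hd0.ne'
          have he0' : (e : ℝ) ≠ 0 := by exact_mod_cast he0.ne'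
          push_cast
          field_simp
        simp_rw [hresc]
        calc ∑ j ∈ Finset.range e, 1 / (2 * distInt ((j : ℝ) / e))
            ≤ (e : ℝ) * (1 + Real.log e) := lemma412_sum_range_inv_distInt_le he0
          _ ≤ (e : ℝ) * (1 + Real.log s) := by
              have he1 : (0 : ℝ) < e := by exact_mod_cast he0
              have hes : (e : ℝ) ≤ s := by exact_mod_cast Nat.div_le_self s d
              have := Real.log_le_log he1 hes
              gcongr
    _ = ∑ _d ∈ s.divisors, (s : ℝ) * (1 + Real.log s) := by
        refine Finset.sum_congr rfl fun d hd => ?_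
        have hds : d ∣ s := Nat.dvd_of_mem_divisors hd
        have : (d : ℝ) * ((s / d : ℕ) : ℝ) = s := by
          rw [← Nat.cast_mul, Nat.mul_div_cancel' hds]
        rw [← mul_assoc, this]
    _ = (Nat.divisors s).card * s * (1 + Real.log s) := by
        rw [Finset.sum_const, nsmul_eq_mul, mul_assoc]


/-! ### The Kloosterman-type sum over a class of an interval (Weil + completion, via `KI`) -/

/-- **Incomplete Kloosterman sum over `{L < m ≤ R : m ≡ t (mod D), (m, s) = 1}`** (from the tree's
`KI_sum_progression_le`, i.e. Weil's bound + completion): for `s ≥ 1`, `(D, s) = 1`, `L ≤ R` and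
`β ∈ ℤ/sℤ`, `‖∑ e_s(β m̄)‖ ≤ ((R − L + 1)/s)(β, s) + τ(s) √s √(β, s) (1 + log s)`.
[cite: BettinChandee2018, Appendix Lemma 1] -/
theorem lemma412_norm_sum_box_kloosterman_le {s D : ℕ} [NeZero s] (hD : 0 < D) (hDs : D.Coprime s)
    {L R : ℕ} (hLR : L ≤ R) (t : ℤ) (β : ZMod s) :
    ‖∑ m ∈ (Finset.Ioc L R).filter (fun m : ℕ => (m : ZMod D) = (t : ZMod D)),
        (if IsUnit (m : ZMod s) then (ZMod.stdAddChar (β * (m : ZMod s)⁻¹) : ℂ) else 0)‖ ≤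
      (((R : ℝ) - L) + 1) / s * Nat.gcd β.val s +
        (Nat.divisors s).card * Real.sqrt s * Real.sqrt (Nat.gcd β.val s) * (1 + Real.log s) := by
  have hs : 0 < s := Nat.pos_of_ne_zero (NeZero.ne s)
  haveI : NeZero D := ⟨hD.ne'⟩
  set v : ℤ := ((t : ZMod D).val : ℤ) with hvdef
  have hv : (v : ZMod D) = (t : ZMod D) := by
    rw [hvdef, Int.cast_natCast, ZMod.natCast_zmod_val]
  set h : ℤ := (β.val : ℤ) with hhdef
  have hβ : (h : ZMod s) = β := by rw [hhdef, Int.cast_natCast, ZMod.natCast_zmod_val]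
  -- the summand as a function of the integer `m`
  set f : ℤ → ℂ := fun m => if Int.gcd m s = 1 then
      Complex.exp (2 * Real.pi * Complex.I *
        ((h : ℂ) * (((((m : ZMod s))⁻¹).val : ℕ) : ℂ) / (s : ℂ))) else 0 with hfdef
  have hsummand : ∀ m : ℕ, (if IsUnit (m : ZMod s) then
      (ZMod.stdAddChar (β * (m : ZMod s)⁻¹) : ℂ) else 0) = f (m : ℤ) := by
    intro m
    have hc : Int.gcd (m : ℤ) s = 1 ↔ IsUnit (m : ZMod s) := by
      rw [hooley_gcd_eq_one_iff_isUnit, Int.cast_natCast]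
    simp only [hfdef]
    by_cases hu : IsUnit (m : ZMod s)
    · rw [if_pos hu, if_pos (hc.mpr hu), hooley_term_eq_stdAddChar, hβ, Int.cast_natCast]
    · rw [if_neg hu, if_neg (fun h' => hu (hc.mp h'))]
  rw [Finset.sum_congr rfl (fun m _ => hsummand m), lemma412_sum_filter_eq_sum_Ioc hD L R t v hv f]
  simp only [hfdef]
  rw [← Finset.sum_filter]
  have hy : ((L : ℤ) - v) / D ≤ ((R : ℤ) - v) / D :=
    Int.ediv_le_ediv (by exact_mod_cast hD) (by
      have : (L : ℤ) ≤ R := by exact_mod_cast hLR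
      linarith)
  refine (KI_sum_progression_le hs hDs h v _ _ hy).trans ?_
  have hg : (Int.gcd h s : ℝ) = (Nat.gcd β.val s : ℝ) := by
    rw [hhdef, Int.gcd_natCast_natCast]
  rw [hg]
  have hlen := lemma412_Ioc_length_le hD hLR v
  have hs0 : (0 : ℝ) < s := by exact_mod_cast hs
  gcongr

/-! ### The finite Fourier expansion modulo `s` of the double sum -/

/-- **The double sum through additive characters modulo `s`.**  For `(a, s) = 1` and any finite
sets `B₁, B₂ ⊂ ℕ`:
`∑_{m₁ ∈ B₁, m₂ ∈ B₂} g_s(m₁m₂; a) = s⁻¹ ∑_{t mod s} E(t) F(t)` with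
`E(t) = ∑_{m₁ ∈ B₁, (m₁,s)=1} (e_s(−t a m̄₁) − S(−t, 0; s)/φ(s))` and `F(t) = ∑_{m₂ ∈ B₂} e_s(t m₂)`
(for `(m₁, s) > 1` every `g_s(m₁m₂; a)` vanishes; for `(m₁, s) = 1`,
`g_s(m₁m₂; a) = G(m₂)` with `G(u) = [u ≡ a m̄₁] − [u unit]/φ(s)`, whose finite Fourier transform is
`Ĝ(t) = e_s(−t a m̄₁) − S(−t, 0; s)/φ(s)`). [folklore] -/
theorem lemma412_sum_gAP_eq_fourier {s : ℕ} [NeZero s] {a : ℤ} (ha : IsUnit (a : ZMod s))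
    (B₁ B₂ : Finset ℕ) :
    (((∑ m₁ ∈ B₁, ∑ m₂ ∈ B₂, gAP s a (m₁ * m₂) : ℝ)) : ℂ) =
      (s : ℂ)⁻¹ * ∑ t : ZMod s,
        (∑ m₁ ∈ B₁, (if IsUnit (m₁ : ZMod s) then
            ((ZMod.stdAddChar (-(t * ((a : ZMod s) * (m₁ : ZMod s)⁻¹))) : ℂ) -
              kloostermanSum s (-t) 0 / (Nat.totient s : ℂ)) else 0)) *
        (∑ m₂ ∈ B₂, (ZMod.stdAddChar (t * (m₂ : ZMod s)) : ℂ)) := by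
  classical
  have hs : 0 < s := Nat.pos_of_ne_zero (NeZero.ne s)
  have hsC : (s : ℂ) ≠ 0 := Nat.cast_ne_zero.mpr hs.ne'
  have hφ : (Nat.totient s : ℂ) ≠ 0 := Nat.cast_ne_zero.mpr (Nat.totient_pos.mpr hs).ne'
  set ψ : AddChar (ZMod s) ℂ := ZMod.stdAddChar with hψ
  set α : ZMod s := (a : ZMod s) with hα
  set φ : ℂ := (Nat.totient s : ℂ) with hφdef
  -- the weight `G_μ` on `ℤ/sℤ`, its transform `Ĝ_μ`, and the unit indicator of `m₁`
  set Gf : ZMod s → ZMod s → ℂ := fun μ u =>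
    (if u = α * μ⁻¹ then 1 else 0) - (if IsUnit u then 1 else 0) / φ with hGf
  set Ghat : ZMod s → ZMod s → ℂ := fun μ t =>
    (ψ (-(t * (α * μ⁻¹))) : ℂ) - kloostermanSum s (-t) 0 / φ with hGhat
  set ind : ℕ → ℂ := fun m₁ => if IsUnit (m₁ : ZMod s) then 1 else 0 with hind
  -- Step 1: `g_s(m₁ m₂; a) = ind(m₁) G_μ(m₂)`
  have hcast_ite : ∀ (P : Prop) [Decidable P],
      (((if P then (1 : ℝ) else 0 : ℝ)) : ℂ) = if P then (1 : ℂ) else 0 := by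
    intro P _; split_ifs <;> simp
  have hstep1 : ∀ m₁ m₂ : ℕ,
      ((gAP s a (m₁ * m₂) : ℝ) : ℂ) = ind m₁ * Gf (m₁ : ZMod s) (m₂ : ZMod s) := by
    intro m₁ m₂
    simp only [gAP, hind, hGf]
    push_cast
    rw [hcast_ite, hcast_ite]
    by_cases hμ : IsUnit (m₁ : ZMod s)
    · rw [if_pos hμ, one_mul]
      have e1 : ((m₁ : ZMod s) * (m₂ : ZMod s) = (a : ZMod s)) ↔
          ((m₂ : ZMod s) = α * (m₁ : ZMod s)⁻¹) := by
        constructor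
        · intro h
          calc (m₂ : ZMod s) = ((m₁ : ZMod s)⁻¹ * (m₁ : ZMod s)) * (m₂ : ZMod s) := by
                rw [ZMod.inv_mul_of_unit _ hμ, one_mul]
            _ = (m₁ : ZMod s)⁻¹ * ((m₁ : ZMod s) * (m₂ : ZMod s)) := by ring
            _ = α * (m₁ : ZMod s)⁻¹ := by rw [h, hα, mul_comm]
        · intro h
          rw [h]
          calc (m₁ : ZMod s) * (α * (m₁ : ZMod s)⁻¹) = α * ((m₁ : ZMod s) * (m₁ : ZMod s)⁻¹) := by
                ring
            _ = (a : ZMod s) := by rw [ZMod.mul_inv_of_unit _ hμ, mul_one, hα]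
      have e2 : (m₁ * m₂).Coprime s ↔ IsUnit (m₂ : ZMod s) := by
        rw [← ZMod.isUnit_iff_coprime, Nat.cast_mul, IsUnit.mul_iff]
        exact ⟨fun h => h.2, fun h => ⟨hμ, h⟩⟩
      simp only [e1, e2, hφdef]
    · rw [if_neg hμ, zero_mul]
      have e1 : ¬ ((m₁ : ZMod s) * (m₂ : ZMod s) = (a : ZMod s)) := by
        intro h
        apply hμ
        have : IsUnit ((m₁ : ZMod s) * (m₂ : ZMod s)) := by rw [h]; exact ha
        exact isUnit_of_mul_isUnit_left this
      have e2 : ¬ (m₁ * m₂).Coprime s := by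
        intro h
        apply hμ
        have : IsUnit ((m₁ : ZMod s) * (m₂ : ZMod s)) := by
          rw [← Nat.cast_mul]; exact (ZMod.isUnit_iff_coprime _ _).mpr h
        exact isUnit_of_mul_isUnit_left this
      rw [if_neg e1, if_neg e2]
      simp
  -- Step 2: the finite Fourier transform of `G_μ`
  have hram : ∀ t : ZMod s,
      ∑ u : ZMod s, (if IsUnit u then (1 : ℂ) else 0) * (ψ (-(t * u)) : ℂ) =
        kloostermanSum s (-t) 0 := by
    intro t
    rw [← hooley_transform_eq_kloostermanSum 0 t]
    refine Finset.sum_congr rfl fun u _ => ?_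
    rw [zero_mul, AddChar.map_zero_eq_one, hψ]
  have hstep2 : ∀ (μ t : ZMod s),
      ∑ u : ZMod s, Gf μ u * (ψ (-(t * u)) : ℂ) = Ghat μ t := by
    intro μ t
    simp only [hGf, hGhat, sub_mul, Finset.sum_sub_distrib]
    congr 1
    · simp_rw [boole_mul]
      rw [Finset.sum_ite_eq' Finset.univ (α * μ⁻¹) (fun u => (ψ (-(t * u)) : ℂ))]
      simp
    · simp_rw [div_mul_eq_mul_div, ← Finset.sum_div]
      rw [hram t]
  -- Step 3: Fourier inversion `G_μ(w) = s⁻¹ ∑_t Ĝ_μ(t) e_s(t w)`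
  have hstep3 : ∀ (μ w : ZMod s),
      Gf μ w = (s : ℂ)⁻¹ * ∑ t : ZMod s, Ghat μ t * (ψ (t * w) : ℂ) := by
    intro μ w
    have hinv := hooley_fourier_inversion (Gf μ) w
    simp_rw [← hψ] at hinv
    simp_rw [hstep2 μ] at hinv
    rw [hinv, ← mul_assoc, inv_mul_cancel₀ hsC, one_mul]
  -- Step 4: assemble
  have hsummand : ∀ (m₁ : ℕ) (t : ZMod s),
      (if IsUnit (m₁ : ZMod s) then
          ((ψ (-(t * (α * (m₁ : ZMod s)⁻¹))) : ℂ) - kloostermanSum s (-t) 0 / φ) else 0) =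
        ind m₁ * Ghat (m₁ : ZMod s) t := by
    intro m₁ t
    simp only [hind, hGhat]
    split_ifs <;> simp
  push_cast
  simp_rw [hstep1, hstep3, hsummand]
  -- both sides equal the triple sum `∑_t ∑_{m₁} ∑_{m₂} s⁻¹ (ind(m₁) Ĝ_{m₁}(t)) e_s(t m₂)`
  have hL : ∑ m₁ ∈ B₁, ∑ m₂ ∈ B₂, ind m₁ *
        ((s : ℂ)⁻¹ * ∑ t, Ghat (m₁ : ZMod s) t * (ψ (t * (m₂ : ZMod s)) : ℂ)) =
      ∑ t, ∑ m₁ ∈ B₁, ∑ m₂ ∈ B₂,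
        (s : ℂ)⁻¹ * (ind m₁ * Ghat (m₁ : ZMod s) t * (ψ (t * (m₂ : ZMod s)) : ℂ)) := by
    calc ∑ m₁ ∈ B₁, ∑ m₂ ∈ B₂, ind m₁ *
          ((s : ℂ)⁻¹ * ∑ t, Ghat (m₁ : ZMod s) t * (ψ (t * (m₂ : ZMod s)) : ℂ))
        = ∑ m₁ ∈ B₁, ∑ m₂ ∈ B₂, ∑ t,
          (s : ℂ)⁻¹ * (ind m₁ * Ghat (m₁ : ZMod s) t * (ψ (t * (m₂ : ZMod s)) : ℂ)) := by
          refine Finset.sum_congr rfl fun m₁ _ => Finset.sum_congr rfl fun m₂ _ => ?_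
          rw [Finset.mul_sum, Finset.mul_sum]
          exact Finset.sum_congr rfl fun t _ => by ring
      _ = ∑ m₁ ∈ B₁, ∑ t, ∑ m₂ ∈ B₂,
          (s : ℂ)⁻¹ * (ind m₁ * Ghat (m₁ : ZMod s) t * (ψ (t * (m₂ : ZMod s)) : ℂ)) :=
          Finset.sum_congr rfl fun m₁ _ => Finset.sum_comm
      _ = _ := Finset.sum_comm
  have hR : (s : ℂ)⁻¹ * ∑ t, (∑ m₁ ∈ B₁, ind m₁ * Ghat (m₁ : ZMod s) t) *
        (∑ m₂ ∈ B₂, (ψ (t * (m₂ : ZMod s)) : ℂ)) =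
      ∑ t, ∑ m₁ ∈ B₁, ∑ m₂ ∈ B₂,
        (s : ℂ)⁻¹ * (ind m₁ * Ghat (m₁ : ZMod s) t * (ψ (t * (m₂ : ZMod s)) : ℂ)) := by
    rw [Finset.mul_sum]
    refine Finset.sum_congr rfl fun t _ => ?_
    rw [Finset.sum_mul_sum, Finset.mul_sum]
    refine Finset.sum_congr rfl fun m₁ _ => ?_
    rw [Finset.mul_sum]
  exact hL.trans hR.symm


/-! ### The core estimate -/

/-- **The core estimate (the classical completion argument, constants explicit).**  For `s ≥ 1`,
`D ≥ 1`, `(D, s) = 1`, `(a, s) = 1`, `L₁ ≤ R₁`, every `A, B` and classes `t₁, t₂ mod D`: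
`|∑_{L₁<m₁≤R₁, m₁≡t₁ (D)} ∑_{A<m₂≤B, m₂≡t₂ (D)} g_s(m₁m₂; a)|`
`≤ τ(s)(1 + log s) · [(R₁ − L₁ + 1)/s + τ(s) √s (1 + log s) + (R₁ − L₁)/φ(s)]`
(finite Fourier expansion modulo `s` in `m₂`, whose zero frequency vanishes identically; Weil's
bound through `KI_sum_progression_le` in `m₁`; geometric sums in `m₂`; the weighted completion sum
`lemma412_sum_gcd_div_distInt_le`). [folklore] -/
theorem lemma412_core {s D : ℕ} [NeZero s] (hD : 0 < D) (hDs : D.Coprime s) {a : ℤ}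
    (ha : IsUnit (a : ZMod s)) {L₁ R₁ : ℕ} (hLR : L₁ ≤ R₁) (A B : ℕ) (t₁ t₂ : ℤ) :
    |∑ m₁ ∈ (Finset.Ioc L₁ R₁).filter (fun m : ℕ => (m : ZMod D) = (t₁ : ZMod D)),
        ∑ m₂ ∈ (Finset.Ioc A B).filter (fun m : ℕ => (m : ZMod D) = (t₂ : ZMod D)),
          gAP s a (m₁ * m₂)| ≤
      (Nat.divisors s).card * (1 + Real.log s) *
        ((((R₁ : ℝ) - L₁) + 1) / s + (Nat.divisors s).card * Real.sqrt s * (1 + Real.log s) +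
          ((R₁ : ℝ) - L₁) / Nat.totient s) := by
  classical
  have hs : 0 < s := Nat.pos_of_ne_zero (NeZero.ne s)
  have hs0 : (0 : ℝ) < s := by exact_mod_cast hs
  have hsC : (s : ℂ) ≠ 0 := Nat.cast_ne_zero.mpr hs.ne'
  have hφ0 : (0 : ℝ) < Nat.totient s := by exact_mod_cast Nat.totient_pos.mpr hs
  have hφC : (Nat.totient s : ℂ) ≠ 0 := Nat.cast_ne_zero.mpr (Nat.totient_pos.mpr hs).ne'
  have hs1 : (1 : ℝ) ≤ s := by exact_mod_cast hs
  have hlog : 0 ≤ 1 + Real.log s := by have := Real.log_nonneg hs1; linarith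
  haveI : NeZero D := ⟨hD.ne'⟩
  set box₁ := (Finset.Ioc L₁ R₁).filter (fun m : ℕ => (m : ZMod D) = (t₁ : ZMod D)) with hbox₁
  set box₂ := (Finset.Ioc A B).filter (fun m : ℕ => (m : ZMod D) = (t₂ : ZMod D)) with hbox₂
  set ψ : AddChar (ZMod s) ℂ := ZMod.stdAddChar with hψ
  set α : ZMod s := (a : ZMod s) with hα
  set τ : ℝ := ((Nat.divisors s).card : ℝ) with hτ
  set N : ℝ := (R₁ : ℝ) - L₁ with hN
  have hN0 : 0 ≤ N := by
    have : (L₁ : ℝ) ≤ R₁ := by exact_mod_cast hLR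
    rw [hN]; linarith
  have hcard₁ : (box₁.card : ℝ) ≤ N := by
    have h1 : box₁.card ≤ (Finset.Ioc L₁ R₁).card := Finset.card_filter_le _ _
    rw [Nat.card_Ioc] at h1
    have h2 : ((box₁.card : ℕ) : ℝ) ≤ ((R₁ - L₁ : ℕ) : ℝ) := by exact_mod_cast h1
    rwa [Nat.cast_sub hLR] at h2
  set W : ℝ := (N + 1) / s + τ * Real.sqrt s * (1 + Real.log s) + N / Nat.totient s with hW
  have hW0 : 0 ≤ W := by positivity
  -- the unit `D mod s`
  set Dz : ZMod s := (D : ZMod s) with hDz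
  have hDu : IsUnit Dz := (ZMod.isUnit_iff_coprime D s).mpr hDs
  -- `E(t)` and `F(t)`
  set E : ZMod s → ℂ := fun t => ∑ m₁ ∈ box₁, (if IsUnit (m₁ : ZMod s) then
      ((ψ (-(t * (α * (m₁ : ZMod s)⁻¹))) : ℂ) - kloostermanSum s (-t) 0 / (Nat.totient s : ℂ))
        else 0) with hE
  set F : ZMod s → ℂ := fun t => ∑ m₂ ∈ box₂, (ψ (t * (m₂ : ZMod s)) : ℂ) with hF
  -- Step 1: the Fourier identity
  have hid : (((∑ m₁ ∈ box₁, ∑ m₂ ∈ box₂, gAP s a (m₁ * m₂) : ℝ)) : ℂ) =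
      (s : ℂ)⁻¹ * ∑ t : ZMod s, E t * F t :=
    lemma412_sum_gAP_eq_fourier ha box₁ box₂
  -- Step 2: the zero frequency vanishes
  have hE0 : E 0 = 0 := by
    simp only [hE]
    refine Finset.sum_eq_zero fun m₁ _ => ?_
    split_ifs
    · simp [lemma412_kloostermanSum_zero_zero, hφC]
    · rfl
  -- Step 3: `‖E(t)‖ ≤ (t, s) W`
  have hgcd : ∀ t : ZMod s, (1 : ℝ) ≤ Nat.gcd t.val s := fun t => by
    exact_mod_cast Nat.gcd_pos_of_pos_right _ hs
  have hEt : ∀ t : ZMod s, ‖E t‖ ≤ (Nat.gcd t.val s : ℝ) * W := by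
    intro t
    set g : ℝ := (Nat.gcd t.val s : ℝ) with hg
    have hg1 : 1 ≤ g := hgcd t
    have hg0 : 0 ≤ g := zero_le_one.trans hg1
    -- split `E(t) = K₁ - K₂`
    set K₁ : ℂ := ∑ m₁ ∈ box₁,
      (if IsUnit (m₁ : ZMod s) then (ψ ((-t * α) * (m₁ : ZMod s)⁻¹) : ℂ) else 0) with hK₁
    set K₂ : ℂ := ∑ m₁ ∈ box₁,
      (if IsUnit (m₁ : ZMod s) then kloostermanSum s (-t) 0 / (Nat.totient s : ℂ) else 0) with hK₂
    have hsplit : E t = K₁ - K₂ := by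
      simp only [hE, hK₁, hK₂]
      rw [← Finset.sum_sub_distrib]
      refine Finset.sum_congr rfl fun m₁ _ => ?_
      split_ifs
      · rw [show -(t * (α * (m₁ : ZMod s)⁻¹)) = (-t * α) * (m₁ : ZMod s)⁻¹ by ring]
      · simp
    -- `K₁` : Weil + completion
    have hβ : Nat.gcd (-t * α).val s = Nat.gcd t.val s := by
      rw [show -t * α = t * (-α) by ring]
      exact lemma412_gcd_val_mul_of_isUnit t ha.neg
    have hK₁le : ‖K₁‖ ≤ (N + 1) / s * g + τ * Real.sqrt s * Real.sqrt g * (1 + Real.log s) := by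
      have := lemma412_norm_sum_box_kloosterman_le hD hDs hLR t₁ (-t * α)
      rw [hβ] at this
      simpa only [hK₁, hψ, hN, hτ, hg] using this
    -- `K₂` : Ramanujan sums
    have hram : ‖kloostermanSum s (-t) 0‖ ≤ g := by
      rw [kloostermanSum_comm]
      refine (norm_kloostermanSum_zero_left_le s (-t)).trans ?_
      rw [hg, show (-t) = t * (-1) by ring, lemma412_gcd_val_mul_of_isUnit t isUnit_one.neg]
    have hK₂le : ‖K₂‖ ≤ N * (g / Nat.totient s) := by
      calc ‖K₂‖ ≤ ∑ m₁ ∈ box₁,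
            ‖(if IsUnit (m₁ : ZMod s) then kloostermanSum s (-t) 0 / (Nat.totient s : ℂ) else 0)‖ :=
            norm_sum_le _ _
        _ ≤ ∑ _m₁ ∈ box₁, g / Nat.totient s := by
            refine Finset.sum_le_sum fun m₁ _ => ?_
            split_ifs
            · rw [norm_div, Complex.norm_natCast]
              exact div_le_div_of_nonneg_right hram hφ0.le
            · rw [norm_zero]; positivity
        _ = box₁.card * (g / Nat.totient s) := by rw [Finset.sum_const, nsmul_eq_mul]
        _ ≤ N * (g / Nat.totient s) := by
            exact mul_le_mul_of_nonneg_right hcard₁ (by positivity)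
    have hsqrt : Real.sqrt g ≤ g := by
      rw [Real.sqrt_le_iff]
      exact ⟨hg0, by nlinarith⟩
    calc ‖E t‖ = ‖K₁ - K₂‖ := by rw [hsplit]
      _ ≤ ‖K₁‖ + ‖K₂‖ := norm_sub_le _ _
      _ ≤ ((N + 1) / s * g + τ * Real.sqrt s * Real.sqrt g * (1 + Real.log s)) +
            N * (g / Nat.totient s) := add_le_add hK₁le hK₂le
      _ ≤ ((N + 1) / s * g + τ * Real.sqrt s * g * (1 + Real.log s)) +
            N * (g / Nat.totient s) := by gcongr
      _ = g * W := by rw [hW]; ring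
  -- Step 4: `‖F(t)‖ ≤ 1/(2‖tD/s‖)` for `t ≠ 0`
  have hFt : ∀ t : ZMod s, t ≠ 0 →
      ‖F t‖ ≤ 1 / (2 * distInt ((((t * Dz).val : ℕ) : ℝ) / s)) := by
    intro t ht
    set v₂ : ℤ := ((t₂ : ZMod D).val : ℤ) with hv₂def
    have hv₂ : (v₂ : ZMod D) = (t₂ : ZMod D) := by
      rw [hv₂def, Int.cast_natCast, ZMod.natCast_zmod_val]
    have hw : t * Dz ≠ 0 := by
      intro h0
      apply ht
      calc t = t * Dz * Dz⁻¹ := by rw [mul_assoc, ZMod.mul_inv_of_unit _ hDu, mul_one]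
        _ = 0 := by rw [h0, zero_mul]
    have hF' : F t = (ψ (t * (v₂ : ZMod s)) : ℂ) *
        ∑ z ∈ Finset.Ioc (((A : ℤ) - v₂) / D) (((B : ℤ) - v₂) / D),
          (ψ ((t * Dz) * (z : ZMod s)) : ℂ) := by
      simp only [hF]
      have h1 : ∑ m₂ ∈ box₂, (ψ (t * (m₂ : ZMod s)) : ℂ) =
          ∑ m₂ ∈ box₂, (ψ (t * (((m₂ : ℕ) : ℤ) : ZMod s)) : ℂ) :=
        Finset.sum_congr rfl fun m₂ _ => by rw [Int.cast_natCast]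
      rw [h1, lemma412_sum_filter_eq_sum_Ioc hD A B t₂ v₂ hv₂
        (fun m : ℤ => (ψ (t * ((m : ℤ) : ZMod s)) : ℂ)), Finset.mul_sum]
      refine Finset.sum_congr rfl fun z _ => ?_
      rw [← AddChar.map_add_eq_mul]
      congr 1
      push_cast
      rw [hDz]
      ring
    rw [hF', norm_mul, hψ, ZMod.stdAddChar_apply, Circle.norm_coe, one_mul]
    exact lemma412_norm_sum_Ioc_stdAddChar_le hw _ _
  -- Step 5: assemble
  have habs : |∑ m₁ ∈ box₁, ∑ m₂ ∈ box₂, gAP s a (m₁ * m₂)| =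
      ‖(((∑ m₁ ∈ box₁, ∑ m₂ ∈ box₂, gAP s a (m₁ * m₂) : ℝ)) : ℂ)‖ := by
    rw [Complex.norm_real, Real.norm_eq_abs]
  rw [habs, hid, norm_mul, norm_inv, Complex.norm_natCast]
  have h0 : E 0 * F 0 = 0 := by rw [hE0, zero_mul]
  rw [← Finset.sum_erase (f := fun t => E t * F t) Finset.univ h0]
  set Φ : ZMod s → ℝ := fun w => 1 / (2 * distInt (((w.val : ℕ) : ℝ) / s)) with hΦ
  have hΦ0 : ∀ w, 0 ≤ Φ w := fun w => by
    simp only [hΦ]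
    exact div_nonneg zero_le_one (mul_nonneg zero_le_two (distInt_nonneg _))
  have hsum : ‖∑ t ∈ (Finset.univ : Finset (ZMod s)).erase 0, E t * F t‖ ≤
      W * (τ * s * (1 + Real.log s)) := by
    calc ‖∑ t ∈ (Finset.univ : Finset (ZMod s)).erase 0, E t * F t‖
        ≤ ∑ t ∈ (Finset.univ : Finset (ZMod s)).erase 0, ‖E t * F t‖ := norm_sum_le _ _
      _ ≤ ∑ t ∈ (Finset.univ : Finset (ZMod s)).erase 0,
            W * ((Nat.gcd t.val s : ℝ) * Φ (t * Dz)) := by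
          refine Finset.sum_le_sum fun t ht => ?_
          have ht0 : t ≠ 0 := Finset.ne_of_mem_erase ht
          rw [norm_mul]
          calc ‖E t‖ * ‖F t‖ ≤ ((Nat.gcd t.val s : ℝ) * W) * Φ (t * Dz) :=
                mul_le_mul (hEt t) (hFt t ht0) (norm_nonneg _) (by positivity)
            _ = W * ((Nat.gcd t.val s : ℝ) * Φ (t * Dz)) := by ring
      _ = W * ∑ t ∈ (Finset.univ : Finset (ZMod s)).erase 0,
            (Nat.gcd t.val s : ℝ) * Φ (t * Dz) := by rw [Finset.mul_sum]
      _ = W * ∑ w ∈ (Finset.univ : Finset (ZMod s)).erase 0,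
            (Nat.gcd w.val s : ℝ) * Φ w := by
          congr 1
          refine Finset.sum_nbij' (fun t => t * Dz) (fun w => w * Dz⁻¹) (fun t ht => ?_)
            (fun w hw => ?_) (fun t _ => ?_) (fun w _ => ?_) (fun t _ => ?_)
          · rw [Finset.mem_erase] at ht ⊢
            refine ⟨fun h0 => ht.1 ?_, Finset.mem_univ _⟩
            have : t * Dz * Dz⁻¹ = 0 := by rw [h0, zero_mul]
            rwa [mul_assoc, ZMod.mul_inv_of_unit _ hDu, mul_one] at this
          · rw [Finset.mem_erase] at hw ⊢
            refine ⟨fun h0 => hw.1 ?_, Finset.mem_univ _⟩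
            have : w * Dz⁻¹ * Dz = 0 := by rw [h0, zero_mul]
            rwa [mul_assoc, mul_comm (Dz⁻¹), ZMod.mul_inv_of_unit _ hDu, mul_one] at this
          · rw [mul_assoc, ZMod.mul_inv_of_unit _ hDu, mul_one]
          · rw [mul_assoc, mul_comm (Dz⁻¹), ZMod.mul_inv_of_unit _ hDu, mul_one]
          · rw [lemma412_gcd_val_mul_of_isUnit t hDu]
      _ ≤ W * (τ * s * (1 + Real.log s)) := by
          refine mul_le_mul_of_nonneg_left ?_ hW0
          have := lemma412_sum_gcd_div_distInt_le s
          simpa only [hΦ, hτ] using this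
  calc (s : ℝ)⁻¹ * ‖∑ t ∈ (Finset.univ : Finset (ZMod s)).erase 0, E t * F t‖
      ≤ (s : ℝ)⁻¹ * (W * (τ * s * (1 + Real.log s))) :=
        mul_le_mul_of_nonneg_left hsum (by positivity)
    _ = τ * (1 + Real.log s) * W := by field_simp
    _ = _ := by rw [hW]


/-! ### Elementary inequalities for the endgame -/

/-- `1 + log s ≤ 81 s^{1/80}` for `s ≥ 1`. [folklore] -/
theorem lemma412_one_add_log_le {s : ℝ} (hs : 1 ≤ s) :
    1 + Real.log s ≤ 81 * s ^ (1 / 80 : ℝ) := by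
  have h1 : 1 ≤ s ^ (1 / 80 : ℝ) := Real.one_le_rpow hs (by norm_num)
  have h2 : Real.log s ≤ s ^ (1 / 80 : ℝ) / (1 / 80) :=
    Real.log_le_rpow_div (by linarith) (by norm_num)
  have h3 : s ^ (1 / 80 : ℝ) / (1 / 80) = 80 * s ^ (1 / 80 : ℝ) := by field_simp
  linarith

/-- The length of a class of `]lo, hi] ⊂ ]M, 2M]`: `⌊hi⌋₊ − ⌊lo⌋₊ ≤ M + 1` when `M ≤ lo`,
`hi ≤ 2M`, `0 ≤ M`. [folklore] -/
theorem lemma412_floor_sub_floor_le {M lo hi : ℝ} (hM : 0 ≤ M) (hlo : M ≤ lo) (hhi : hi ≤ 2 * M) :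
    (⌊hi⌋₊ : ℝ) - ⌊lo⌋₊ ≤ M + 1 := by
  have h1 : (⌊hi⌋₊ : ℝ) ≤ 2 * M := by
    rcases le_or_gt 0 hi with h | h
    · exact (Nat.floor_le h).trans hhi
    · rw [Nat.floor_of_nonpos h.le, Nat.cast_zero]; linarith
  have h2 : lo < (⌊lo⌋₊ : ℝ) + 1 := Nat.lt_floor_add_one lo
  linarith

end FouvryTenenbaum2021

/-! ### Lemma 4.12 (4.16) — PROVED -/

open FouvryTenenbaum2021 in
/-- **Fouvry–Tenenbaum 2021, Lemma 4.12, (4.16) — PROVED** (discharges the named fact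
`FouvryTenenbaum2021_lemma412`: `τ₂` in arithmetic progressions to level `x^{3/5}` with unit classes
`mod D` on both variables), with `δ = 1/20`, `C₀ = 0` and `C = 81 C_τ (6 + 81 C_τ)`, `C_τ` the constant
of the divisor bound `τ(s) ≤ C_τ s^{1/80}`.  "A classical consequence of Weil's bound for Kloosterman
sums" (source, p. 20): by `lemma412_core`,
`|∑∑ g_s(m₁m₂; a)| φ(s) ≤ τ(s)(1 + log s)[2(M₁ + 2) + τ(s) s^{3/2} (1 + log s)] ≤ C x^{19/20}`
for `s ≤ x^{3/5}`, `M₁ ≤ √x`, using the tree's PROVED Weil bound (`weil_kloosterman_bound_holds`,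
through `KI_sum_progression_le`). [cite: FouvryTenenbaum2021, Lemma 4.12] -/
theorem FouvryTenenbaum2021_lemma412_holds : FouvryTenenbaum2021_lemma412 := by
  obtain ⟨C₁, hC₁1, hC₁⟩ := exists_card_divisors_le_mul_rpow (show (0 : ℝ) < 1 / 80 by norm_num)
  refine ⟨1 / 20, 0, C₁ * 81 * (6 + C₁ * 81), by norm_num, ?_⟩
  intro x hx M₁ M₂ lo₁ hi₁ lo₂ hi₂ hM₁ hM₁₂ hMx hlo₁ hhi₁ _hlo₂ _hhi₂ s D a t₁ t₂ hs hsx hD hsaD _ht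
  haveI : NeZero s := ⟨by omega⟩
  have hs0 : 0 < s := by omega
  have hs0' : (0 : ℝ) < s := by exact_mod_cast hs0
  have hs1 : (1 : ℝ) ≤ s := by exact_mod_cast hs
  have hx0 : 0 < x := by linarith
  have hφ0 : (0 : ℝ) < Nat.totient s := by exact_mod_cast Nat.totient_pos.mpr hs0
  have hφs : (Nat.totient s : ℝ) ≤ s := by exact_mod_cast Nat.totient_le s
  have hC₁0 : 0 ≤ C₁ := zero_le_one.trans hC₁1
  -- `(a, s) = 1`, `(D, s) = 1`
  have ha : IsUnit (a : ZMod s) := (ZMod.coe_int_isUnit_iff_isCoprime a s).mpr hsaD.of_mul_right_left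
  have hDs : D.Coprime s := (Nat.isCoprime_iff_coprime.mp hsaD.of_mul_right_right).symm
  have hD0 : 0 < D := hD
  -- the right-hand side
  have hRHS : C₁ * 81 * (6 + C₁ * 81) * (D : ℝ) ^ (0 : ℝ) * x ^ (1 - 1 / 20 : ℝ) / (Nat.totient s : ℝ) =
      C₁ * 81 * (6 + C₁ * 81) * x ^ (19 / 20 : ℝ) / (Nat.totient s : ℝ) := by
    rw [Real.rpow_zero, mul_one, show (1 - 1 / 20 : ℝ) = 19 / 20 by norm_num]
  rw [hRHS]
  have hRHS0 : 0 ≤ C₁ * 81 * (6 + C₁ * 81) * x ^ (19 / 20 : ℝ) / (Nat.totient s : ℝ) := by positivity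
  -- empty `m₁`-range
  rcases lt_or_ge ⌊hi₁⌋₊ ⌊lo₁⌋₊ with hlt | hLR
  · rw [Finset.Ioc_eq_empty_of_le hlt.le, Finset.filter_empty, Finset.sum_empty, abs_zero]
    exact hRHS0
  -- the core estimate
  refine (lemma412_core hD0 hDs ha hLR ⌊lo₂⌋₊ ⌊hi₂⌋₊ t₁ t₂).trans ?_
  -- sizes
  set τ : ℝ := ((Nat.divisors s).card : ℝ) with hτ
  set N : ℝ := (⌊hi₁⌋₊ : ℝ) - ⌊lo₁⌋₊ with hN
  set φ : ℝ := (Nat.totient s : ℝ) with hφ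
  have hM₁0 : 0 ≤ M₁ := (Real.rpow_nonneg hx0.le _).trans hM₁
  have hM₁x : M₁ ≤ Real.sqrt x := by
    have h1 : M₁ ^ 2 ≤ x := by nlinarith
    have h2 := Real.sqrt_le_sqrt h1
    rwa [Real.sqrt_sq hM₁0] at h2
  have hsqx1 : 1 ≤ Real.sqrt x := Real.one_le_sqrt.mpr hx
  have hN1 : N + 1 ≤ 3 * Real.sqrt x := by
    have := lemma412_floor_sub_floor_le hM₁0 hlo₁ hhi₁
    rw [hN]; linarith
  have hN0 : 0 ≤ N := by
    have : ((⌊lo₁⌋₊ : ℕ) : ℝ) ≤ ⌊hi₁⌋₊ := by exact_mod_cast hLR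
    rw [hN]; linarith
  -- `s ≤ x`, powers of `s` against powers of `x`
  have hsx1 : (s : ℝ) ≤ x := hsx.trans (by
    have := Real.rpow_le_rpow_of_exponent_le hx (show (3 / 5 : ℝ) ≤ 1 by norm_num)
    rwa [Real.rpow_one] at this)
  have hs80 : (s : ℝ) ^ (1 / 80 : ℝ) ≤ x ^ (1 / 80 : ℝ) :=
    Real.rpow_le_rpow hs0'.le hsx1 (by norm_num)
  have hsqs : Real.sqrt s ≤ x ^ (3 / 10 : ℝ) := by
    have h1 := Real.sqrt_le_sqrt hsx
    rw [Real.sqrt_eq_rpow, Real.sqrt_eq_rpow, ← Real.rpow_mul hx0.le] at h1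
    rw [Real.sqrt_eq_rpow]
    refine h1.trans (le_of_eq ?_)
    norm_num
  -- `τ(s)(1 + log s) ≤ P := 81 C₁ x^{1/40}`
  set P : ℝ := C₁ * 81 * x ^ (1 / 40 : ℝ) with hP
  have hP0 : 0 ≤ P := by positivity
  have hτle : τ ≤ C₁ * x ^ (1 / 80 : ℝ) :=
    (hC₁ s hs0.ne').trans (mul_le_mul_of_nonneg_left hs80 hC₁0)
  have hlogle : 1 + Real.log s ≤ 81 * x ^ (1 / 80 : ℝ) :=
    (lemma412_one_add_log_le hs1).trans (mul_le_mul_of_nonneg_left hs80 (by norm_num))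
  have hlog0 : 0 ≤ 1 + Real.log s := by have := Real.log_nonneg hs1; linarith
  have hx40 : x ^ (1 / 80 : ℝ) * x ^ (1 / 80 : ℝ) = x ^ (1 / 40 : ℝ) := by
    rw [← Real.rpow_add hx0]; norm_num
  have hτlog : τ * (1 + Real.log s) ≤ P := by
    calc τ * (1 + Real.log s) ≤ (C₁ * x ^ (1 / 80 : ℝ)) * (81 * x ^ (1 / 80 : ℝ)) :=
          mul_le_mul hτle hlogle hlog0 (by positivity)
      _ = P := by rw [hP, ← hx40]; ring
  -- the bracket
  have hbr : (N + 1) / s + τ * Real.sqrt s * (1 + Real.log s) + N / φ ≤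
      6 * Real.sqrt x / φ + P * x ^ (3 / 10 : ℝ) := by
    have h1 : (N + 1) / s ≤ (N + 1) / φ := div_le_div_of_nonneg_left (by positivity) hφ0 hφs
    have h2 : N / φ ≤ (N + 1) / φ := div_le_div_of_nonneg_right (by linarith) hφ0.le
    have h3 : (N + 1) / φ + (N + 1) / φ ≤ 6 * Real.sqrt x / φ := by
      rw [← add_div]
      exact div_le_div_of_nonneg_right (by linarith) hφ0.le
    have h4 : τ * Real.sqrt s * (1 + Real.log s) ≤ P * x ^ (3 / 10 : ℝ) := by
      calc τ * Real.sqrt s * (1 + Real.log s) = (τ * (1 + Real.log s)) * Real.sqrt s := by ring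
        _ ≤ P * x ^ (3 / 10 : ℝ) := mul_le_mul hτlog hsqs (Real.sqrt_nonneg _) hP0
    linarith
  have hbr0 : 0 ≤ (N + 1) / s + τ * Real.sqrt s * (1 + Real.log s) + N / φ := by positivity
  -- assemble
  have hφx : φ ≤ x ^ (3 / 5 : ℝ) := hφs.trans hsx
  calc τ * (1 + Real.log s) * ((N + 1) / s + τ * Real.sqrt s * (1 + Real.log s) + N / φ)
      ≤ P * (6 * Real.sqrt x / φ + P * x ^ (3 / 10 : ℝ)) := mul_le_mul hτlog hbr hbr0 hP0
    _ = (6 * P * Real.sqrt x + P * P * x ^ (3 / 10 : ℝ) * φ) / φ := by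
        field_simp
    _ ≤ (6 * P * Real.sqrt x + P * P * x ^ (3 / 10 : ℝ) * x ^ (3 / 5 : ℝ)) / φ := by
        gcongr
    _ = (6 * 81 * C₁ * (x ^ (1 / 40 : ℝ) * x ^ (1 / 2 : ℝ)) +
          81 * 81 * C₁ * C₁ * (x ^ (1 / 40 : ℝ) * x ^ (1 / 40 : ℝ) *
            (x ^ (3 / 10 : ℝ) * x ^ (3 / 5 : ℝ)))) / φ := by
        rw [hP, Real.sqrt_eq_rpow]; ring
    _ = (6 * 81 * C₁ * x ^ (21 / 40 : ℝ) + 81 * 81 * C₁ * C₁ * x ^ (19 / 20 : ℝ)) / φ := by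
        rw [← Real.rpow_add hx0, ← Real.rpow_add hx0, ← Real.rpow_add hx0, ← Real.rpow_add hx0]
        norm_num
    _ ≤ (6 * 81 * C₁ * x ^ (19 / 20 : ℝ) + 81 * 81 * C₁ * C₁ * x ^ (19 / 20 : ℝ)) / φ := by
        have : x ^ (21 / 40 : ℝ) ≤ x ^ (19 / 20 : ℝ) :=
          Real.rpow_le_rpow_of_exponent_le hx (by norm_num)
        gcongr
    _ = C₁ * 81 * (6 + C₁ * 81) * x ^ (19 / 20 : ℝ) / φ := by ring

end Literature.NumberTheory.Sieve

end
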